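import Mathlib.Analysis.InnerProductSpace.Adjoint
import Mathlib.Analysis.Normed.Operator.Extend
import Mathlib.MeasureTheory.Function.L2Space
import Mathlib.Analysis.SpecialFunctions.ImproperIntegrals
import Mathlib.MeasureTheory.Integral.ExpDecay
import Mathlib.Analysis.Calculus.ParametricIntegral
import Mathlib.Analysis.Complex.CauchyIntegral
import Mathlib.Analysis.Complex.Convex
import Mathlib.Analysis.Analytic.Uniqueness
import HarnessLib

/-!
# The contraction/adjoint step of de Branges' positivity theorem (Conrey–Li 2000, Theorem 2, (2.7)–(2.8))

LABEL (line 1): RH-FREE functional analysis (a Schur-class extension lemma for the Szegő-type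
kernel `L(w, z) = 1/(2πi(w̄ − z − i))` of the half-plane `Im z > −1/2`). bears_on: B-C/B-P
(LADDER-RH §1, COLUMN 6 DBR) — it is the analytic-continuation half of the named fact
`Literature.Analysis.DeBrangesSpaces.conreyLi2000_thm2`. WHAT THIS IS NOT: not progress toward RH;
the hypothesis of Conrey–Li's Theorem 2 FAILS for `W = 1/ξ(1 − iz)` (Conrey–Li §3; tree barrier
`Literature.Barriers.RiemannHypothesis.ConreyLi2000_FW_holds`); nothing here bears on the truth of RH.

J. B. Conrey, X.-J. Li, *A note on some positivity conditions related to zeta and L-functions*,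
IMRN 2000:18, 929–940 = arXiv:math/9812166, proof of Theorem 2, second half (arXiv p. 2 line 108 –
p. 3 line 24, read first-hand in the held text `paper:arxiv-math_9812166`):

> Let `𝓗` be the Hilbert space of analytic functions in the half-plane `Im z > −1/2`, which has
> the expression `L(w, z) = 1/2πi(w̄ − z − i)` as its reproducing kernel function. […] Let `P` be a
> transformation of `𝓗` into itself, which takes `L(w, z)` into `B̄(w)L(w, z)`. The
> positive-definiteness of the expression `(1 − B(z)B̄(w))/(2πi(w̄ − z − i))` implies
> `⟨PF, PF⟩ ≤ ⟨F, F⟩` for all elements `F ∈ 𝓗` which are linear combination of functions `L(w, z)`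
> with `Im w > 0`. […] Thus, `P` is a bounded linear transformation […] and therefore, the adjoint
> `P*` of `P` exists. […] `2πi(ᾱ − w − i)⟨P*F(z), L(w, z)⟩ = […] = B(w)` for `w` in the upper
> half-plane, `B(z)` has an analytic extension to the half-plane `Im z > −1/2`. If `F ∈ 𝓗` and
> `Im w > 0`, we have `B(w)F(w) = ⟨P*F(z), L(w, z)⟩` (2.7). Since both sides of (2.7) are analytic
> […] the identity (2.7) remains true for all complex `w` with `Im w > −1/2` […]
> `|B(w)F(w)|² ≤ ⟨F, F⟩ L(w, w)` (2.8) […] that is, `|B(w)| ≤ 1` for `Im w > −1/2`.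

## What is proved (theorems only; no definitions, no named facts)

* `SzegoSchur.schur_extension_abstract`: the printed argument over an ABSTRACT Hilbert space `H`
  carrying vectors `ℓ z` (`Im z > −1/2`) with non-vanishing Gram entries and holomorphic
  evaluations `z ↦ ⟪ℓ z, F⟫`: if `B : ℂ → ℂ` makes the Hermitian form
  `Σ c̄_i c_j (1 − B(w_i) B̄(w_j)) ⟪ℓ w_i, ℓ w_j⟫` non-negative on finite families of points of the
  open upper half-plane, then `B` extends analytically to `Im z > −1/2` with `|B| ≤ 1`.
* `szego_schur_extension`: the printed statement, with `⟪ℓ w_i, ℓ w_j⟫` the printed kernel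
  `L(w_j, w_i) = 1/(2πi(w̄_j − w_i − i))` (realised in `L²(0, ∞)` by `t ↦ e^{−it w̄ − t/2}`,
  `∫₀^∞ e^{itw} e^{−it z̄} e^{−t} dt = 1/(i(z̄ − w − i))`).

Deviations from the printed proof (why): (d1) `𝓗` is modelled concretely inside `L²((0,∞))`
(Mathlib has no Hardy space of a half-plane); only the Gram identity and the holomorphy of
`z ↦ ⟪ℓ z, F⟫` are used, exactly the two properties the printed proof uses of `𝓗`. (d2) The printed
density of `{L(w, ·) : Im w > 0}` in `𝓗` is NOT needed: `P` is built on the CLOSED SPAN `V` of these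
kernel vectors (extension of a densely defined contraction, Mathlib `LinearMap.extendOfNorm`),
`P*` is its Hilbert adjoint on `V`, (2.7) is continued by the identity theorem, and in (2.8) the
vector `F = L(w, ·)` is replaced by its orthogonal projection onto `V` (non-zero because
`⟨L(i, ·), L(w, ·)⟩ = L(i, w) ≠ 0`).

## References

* [ConreyLi2000] J. B. Conrey, X.-J. Li, IMRN 2000:18, 929–940 = arXiv:math/9812166, proof of
  Theorem 2, (2.7)–(2.8) (read: arXiv pp. 2–3).
* [deBranges1968] L. de Branges, *Hilbert spaces of entire functions*, Prentice-Hall 1968 (the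
  contraction/adjoint technique; "essentially due to de Branges", Conrey–Li p. 1).
-/

noncomputable section

open scoped ComplexConjugate Real Topology InnerProductSpace
open _root_.Complex _root_.MeasureTheory _root_.Filter _root_.Set

namespace Literature.Analysis.DeBrangesSpaces

namespace SzegoSchur

variable {H : Type*} [NormedAddCommGroup H] [InnerProductSpace ℂ H]

/-! ### Finite Hermitian sums -/

/-- `⟪Σ dᵢ vᵢ, Σ dⱼ vⱼ⟫ = Σᵢ Σⱼ d̄ᵢ dⱼ ⟪vᵢ, vⱼ⟫`. [folklore] -/
private theorem inner_sum_smul_sum_smul {ι : Type*} (s : Finset ι) (d : ι → ℂ) (v : ι → H) :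
    ⟪∑ i ∈ s, d i • v i, ∑ j ∈ s, d j • v j⟫_ℂ = ∑ i ∈ s, ∑ j ∈ s, conj (d i) * d j * ⟪v i, v j⟫_ℂ := by
  rw [sum_inner]
  refine Finset.sum_congr rfl fun i _ ↦ ?_
  rw [inner_sum]
  refine Finset.sum_congr rfl fun j _ ↦ ?_
  rw [inner_smul_left, inner_smul_right]
  ring

/-- **The contraction inequality on finite combinations** ("the positive-definiteness of
`(1 − B(z)B̄(w))/(2πi(w̄ − z − i))` implies `⟨PF, PF⟩ ≤ ⟨F, F⟩` for `F` a linear combination of the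
`L(w, ·)`, `Im w > 0`"): `‖Σ cᵢ B̄(wᵢ) ℓ(wᵢ)‖ ≤ ‖Σ cᵢ ℓ(wᵢ)‖`. [cite: ConreyLi2000, proof of Theorem 2] -/
theorem norm_sum_conjB_smul_le (ℓ : ℂ → H) (B : ℂ → ℂ)
    (hpsd : ∀ (ι : Type) (s : Finset ι) (w : ι → ℂ) (c : ι → ℂ), (∀ i ∈ s, 0 < (w i).im) →
      0 ≤ (∑ i ∈ s, ∑ j ∈ s,
        conj (c i) * c j * (1 - B (w i) * conj (B (w j))) * ⟪ℓ (w i), ℓ (w j)⟫_ℂ).re)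
    {ι : Type} (s : Finset ι) (w : ι → ℂ) (c : ι → ℂ) (hw : ∀ i ∈ s, 0 < (w i).im) :
    ‖∑ i ∈ s, (c i * conj (B (w i))) • ℓ (w i)‖ ≤ ‖∑ i ∈ s, c i • ℓ (w i)‖ := by
  set u : H := ∑ i ∈ s, c i • ℓ (w i) with hu
  set v : H := ∑ i ∈ s, (c i * conj (B (w i))) • ℓ (w i) with hv
  have huu : ⟪u, u⟫_ℂ = ∑ i ∈ s, ∑ j ∈ s, conj (c i) * c j * ⟪ℓ (w i), ℓ (w j)⟫_ℂ :=
    inner_sum_smul_sum_smul s c (fun i ↦ ℓ (w i))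
  have hvv : ⟪v, v⟫_ℂ = ∑ i ∈ s, ∑ j ∈ s,
      conj (c i * conj (B (w i))) * (c j * conj (B (w j))) * ⟪ℓ (w i), ℓ (w j)⟫_ℂ :=
    inner_sum_smul_sum_smul s (fun i ↦ c i * conj (B (w i))) (fun i ↦ ℓ (w i))
  have hdiff : ⟪u, u⟫_ℂ - ⟪v, v⟫_ℂ = ∑ i ∈ s, ∑ j ∈ s,
      conj (c i) * c j * (1 - B (w i) * conj (B (w j))) * ⟪ℓ (w i), ℓ (w j)⟫_ℂ := by
    rw [huu, hvv, ← Finset.sum_sub_distrib]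
    refine Finset.sum_congr rfl fun i _ ↦ ?_
    rw [← Finset.sum_sub_distrib]
    refine Finset.sum_congr rfl fun j _ ↦ ?_
    simp only [map_mul, Complex.conj_conj]
    ring
  have hre : 0 ≤ (⟪u, u⟫_ℂ - ⟪v, v⟫_ℂ).re := by
    rw [hdiff]; exact hpsd ι s w c hw
  have hu2 : (⟪u, u⟫_ℂ).re = ‖u‖ ^ 2 := by
    rw [inner_self_eq_norm_sq_to_K]; norm_cast
  have hv2 : (⟪v, v⟫_ℂ).re = ‖v‖ ^ 2 := by
    rw [inner_self_eq_norm_sq_to_K]; norm_cast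
  rw [Complex.sub_re, hu2, hv2] at hre
  have : ‖v‖ ^ 2 ≤ ‖u‖ ^ 2 := by linarith
  exact (pow_le_pow_iff_left₀ (norm_nonneg _) (norm_nonneg _) two_ne_zero).1 this

variable [CompleteSpace H]

/-- **The operator `P`** ("Let `P` be a transformation of `𝓗` into itself which takes `L(w, z)` into
`B̄(w)L(w, z)` … `P` is a bounded linear transformation"): on the closed span `V` of the kernel
vectors `ℓ w`, `Im w > 0`, there is a contraction `P` with `P ℓ(w) = B̄(w) ℓ(w)`. (Built on the span
by the contraction inequality, extended by continuity to the closure.)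
[cite: ConreyLi2000, proof of Theorem 2] -/
theorem exists_contraction (ℓ : ℂ → H) (B : ℂ → ℂ)
    (hpsd : ∀ (ι : Type) (s : Finset ι) (w : ι → ℂ) (c : ι → ℂ), (∀ i ∈ s, 0 < (w i).im) →
      0 ≤ (∑ i ∈ s, ∑ j ∈ s,
        conj (c i) * c j * (1 - B (w i) * conj (B (w j))) * ⟪ℓ (w i), ℓ (w j)⟫_ℂ).re) :
    ∃ P : (Submodule.span ℂ (Set.range fun u : {z : ℂ // 0 < z.im} ↦ ℓ u)).topologicalClosure
        →L[ℂ] (Submodule.span ℂ (Set.range fun u : {z : ℂ // 0 < z.im} ↦ ℓ u)).topologicalClosure,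
      ‖P‖ ≤ 1 ∧ ∀ v : (Submodule.span ℂ (Set.range fun u : {z : ℂ // 0 < z.im} ↦ ℓ u)).topologicalClosure,
        ∀ w : ℂ, 0 < w.im → (v : H) = ℓ w → (P v : H) = conj (B w) • ℓ w := by
  set V₀ : Submodule ℂ H := Submodule.span ℂ (Set.range fun u : {z : ℂ // 0 < z.im} ↦ ℓ u) with hV₀
  set V := V₀.topologicalClosure with hV
  -- the two linear maps on finitely supported coefficient vectors
  let Φ : ({z : ℂ // 0 < z.im} →₀ ℂ) →ₗ[ℂ] H :=
    Finsupp.linearCombination ℂ (fun u : {z : ℂ // 0 < z.im} ↦ ℓ u)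
  let Ψ : ({z : ℂ // 0 < z.im} →₀ ℂ) →ₗ[ℂ] H :=
    Finsupp.linearCombination ℂ (fun u : {z : ℂ // 0 < z.im} ↦ conj (B u) • ℓ u)
  have hΦmem : ∀ c, Φ c ∈ V := by
    intro c
    apply V₀.le_topologicalClosure
    have : Φ c ∈ LinearMap.range Φ := LinearMap.mem_range_self Φ c
    rwa [Finsupp.range_linearCombination] at this
  have hℓmem : ∀ u : {z : ℂ // 0 < z.im}, ℓ u ∈ V₀ := fun u ↦
    Submodule.subset_span (Set.mem_range_self u)
  have hΨmem₀ : ∀ c, Ψ c ∈ V₀ := by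
    intro c
    change (Finsupp.linearCombination ℂ (fun u : {z : ℂ // 0 < z.im} ↦ conj (B u) • ℓ u)) c ∈ V₀
    rw [Finsupp.linearCombination_apply]
    exact Submodule.sum_mem _ fun u _ ↦ Submodule.smul_mem _ _ (Submodule.smul_mem _ _ (hℓmem u))
  have hΨmem : ∀ c, Ψ c ∈ V := fun c ↦ V₀.le_topologicalClosure (hΨmem₀ c)
  let e : ({z : ℂ // 0 < z.im} →₀ ℂ) →ₗ[ℂ] V := Φ.codRestrict V hΦmem
  let f : ({z : ℂ // 0 < z.im} →₀ ℂ) →ₗ[ℂ] V := Ψ.codRestrict V hΨmem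
  -- explicit sums
  have hΦsum : ∀ c : {z : ℂ // 0 < z.im} →₀ ℂ, Φ c = ∑ u ∈ c.support, c u • ℓ u := fun c ↦ by
    change (Finsupp.linearCombination ℂ (fun u : {z : ℂ // 0 < z.im} ↦ ℓ u)) c = _
    rw [Finsupp.linearCombination_apply]; rfl
  have hΨsum : ∀ c : {z : ℂ // 0 < z.im} →₀ ℂ,
      Ψ c = ∑ u ∈ c.support, (c u * conj (B u)) • ℓ u := fun c ↦ by
    change (Finsupp.linearCombination ℂ (fun u : {z : ℂ // 0 < z.im} ↦ conj (B u) • ℓ u)) c = _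
    rw [Finsupp.linearCombination_apply]
    change ∑ u ∈ c.support, c u • (conj (B u) • ℓ u) = _
    refine Finset.sum_congr rfl fun u _ ↦ ?_
    rw [smul_smul]
  -- the norm estimate
  have hnorm : ∀ c, ‖f c‖ ≤ 1 * ‖e c‖ := by
    intro c
    rw [one_mul]
    change ‖Ψ c‖ ≤ ‖Φ c‖
    rw [hΦsum, hΨsum]
    exact norm_sum_conjB_smul_le ℓ B hpsd c.support (fun u ↦ (u : ℂ)) (fun u ↦ c u)
      (fun u _ ↦ u.2)
  -- density of the range of `e` in `V`
  have hdense : DenseRange e := by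
    rw [DenseRange, Subtype.dense_iff]
    have hsub : (V₀ : Set H) ⊆ Subtype.val '' Set.range e := by
      intro y hy
      have hy' : y ∈ LinearMap.range Φ := by rwa [Finsupp.range_linearCombination]
      obtain ⟨c, rfl⟩ := hy'
      exact ⟨e c, ⟨c, rfl⟩, rfl⟩
    intro x hx
    exact closure_mono hsub hx
  -- the extension
  refine ⟨f.extendOfNorm e, LinearMap.opNorm_extendOfNorm_le hdense zero_le_one hnorm, ?_⟩
  intro v w hw hvw
  let u₀ : {z : ℂ // 0 < z.im} := ⟨w, hw⟩
  have hev : e (Finsupp.single u₀ 1) = v := by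
    apply Subtype.ext
    change Φ (Finsupp.single u₀ 1) = (v : H)
    rw [hvw]
    change (Finsupp.linearCombination ℂ (fun u : {z : ℂ // 0 < z.im} ↦ ℓ u)) (Finsupp.single u₀ 1) = _
    rw [Finsupp.linearCombination_single, one_smul]
  rw [← hev, LinearMap.extendOfNorm_eq hdense ⟨1, hnorm⟩]
  change Ψ (Finsupp.single u₀ 1) = _
  change (Finsupp.linearCombination ℂ (fun u : {z : ℂ // 0 < z.im} ↦ conj (B u) • ℓ u))
    (Finsupp.single u₀ 1) = _
  rw [Finsupp.linearCombination_single, one_smul]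

/-- **(2.7)–(2.8), abstract form.** Let `H` be a Hilbert space with vectors `ℓ z` (used for
`Im z > −1/2`) such that `⟪ℓ z, ℓ w⟫ ≠ 0` and `z ↦ ⟪ℓ z, F⟫` is holomorphic on `Im z > −1/2` for
every `F` (the printed `F(z) = ⟨F, L(z, ·)⟩_𝓗`, `L(z, w) ≠ 0`). If `B : ℂ → ℂ` makes the Hermitian
form `Σᵢⱼ c̄ᵢ cⱼ (1 − B(wᵢ)B̄(wⱼ)) ⟪ℓ wᵢ, ℓ wⱼ⟫` non-negative for all finite families of points of the
open upper half-plane, then `B` has an analytic extension `B₁` to `Im z > −1/2` with `|B₁| ≤ 1`.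
Proof = the printed one: contraction `P` on the closed span `V` of the `ℓ w` (`Im w > 0`), adjoint
`P*`, `B₁(z) := ⟪ℓ z, P* ℓ i⟫/⟪ℓ z, ℓ i⟫`, (2.7) by the identity theorem on the convex set
`Im z > −1/2`, (2.8) with `F` the orthogonal projection of `ℓ z` onto `V`.
[cite: ConreyLi2000, proof of Theorem 2, (2.7)–(2.8)] -/
theorem schur_extension_abstract (ℓ : ℂ → H)
    (hne : ∀ z w : ℂ, -1 / 2 < z.im → -1 / 2 < w.im → ⟪ℓ z, ℓ w⟫_ℂ ≠ 0)
    (han : ∀ F : H, DifferentiableOn ℂ (fun z ↦ ⟪ℓ z, F⟫_ℂ) {z : ℂ | -1 / 2 < z.im})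
    (B : ℂ → ℂ)
    (hpsd : ∀ (ι : Type) (s : Finset ι) (w : ι → ℂ) (c : ι → ℂ), (∀ i ∈ s, 0 < (w i).im) →
      0 ≤ (∑ i ∈ s, ∑ j ∈ s,
        conj (c i) * c j * (1 - B (w i) * conj (B (w j))) * ⟪ℓ (w i), ℓ (w j)⟫_ℂ).re) :
    ∃ B₁ : ℂ → ℂ, DifferentiableOn ℂ B₁ {z : ℂ | -1 / 2 < z.im} ∧
      Set.EqOn B₁ B {z : ℂ | 0 < z.im} ∧ ∀ z : ℂ, -1 / 2 < z.im → ‖B₁ z‖ ≤ 1 := by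
  set V₀ : Submodule ℂ H := Submodule.span ℂ (Set.range fun u : {z : ℂ // 0 < z.im} ↦ ℓ u) with hV₀
  set V := V₀.topologicalClosure with hV
  obtain ⟨P, hP1, hPℓ⟩ := exists_contraction ℓ B hpsd
  have hℓmem : ∀ w : ℂ, 0 < w.im → ℓ w ∈ V := fun w hw ↦
    V₀.le_topologicalClosure (Submodule.subset_span (Set.mem_range_self (⟨w, hw⟩ : {z : ℂ // 0 < z.im})))
  -- the adjoint `P*`
  let Pa : V →L[ℂ] V := ContinuousLinearMap.adjoint P
  have hPa1 : ‖Pa‖ ≤ 1 := by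
    change ‖ContinuousLinearMap.adjoint P‖ ≤ 1
    rw [LinearIsometryEquiv.norm_map]; exact hP1
  -- (2.7) on the upper half-plane
  have h27 : ∀ (F : V) (w : ℂ), 0 < w.im →
      ⟪ℓ w, ((Pa F : V) : H)⟫_ℂ = B w * ⟪ℓ w, (F : H)⟫_ℂ := by
    intro F w hw
    have h := ContinuousLinearMap.adjoint_inner_right P ⟨ℓ w, hℓmem w hw⟩ F
    rw [Submodule.coe_inner, Submodule.coe_inner] at h
    change ⟪ℓ w, ((Pa F : V) : H)⟫_ℂ = _ at h
    rw [h, hPℓ ⟨ℓ w, hℓmem w hw⟩ w hw rfl, inner_smul_left, Complex.conj_conj]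
  -- the base point `i`
  have hI : (0 : ℝ) < (I : ℂ).im := by simp
  have hI' : (-1 / 2 : ℝ) < (I : ℂ).im := by simp; norm_num
  set G₀ : V := Pa ⟨ℓ I, hℓmem I hI⟩ with hG₀
  -- the candidate extension
  set B₁ : ℂ → ℂ := fun z ↦ ⟪ℓ z, (G₀ : H)⟫_ℂ / ⟪ℓ z, ℓ I⟫_ℂ with hB₁
  have hB₁diff : DifferentiableOn ℂ B₁ {z : ℂ | -1 / 2 < z.im} :=
    (han (G₀ : H)).div (han (ℓ I)) fun z hz ↦ hne z I hz hI'
  have hB₁eq : Set.EqOn B₁ B {z : ℂ | 0 < z.im} := by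
    intro w hw
    have hw' : (-1 / 2 : ℝ) < w.im := by
      have : (0 : ℝ) < w.im := hw
      linarith
    simp only [hB₁, hG₀]
    rw [h27 _ w hw]
    change B w * ⟪ℓ w, ℓ I⟫_ℂ / ⟪ℓ w, ℓ I⟫_ℂ = B w
    rw [mul_div_assoc, div_self (hne w I hw' hI'), mul_one]
  refine ⟨B₁, hB₁diff, hB₁eq, ?_⟩
  intro z hz
  -- (2.7) continued analytically to `Im z > −1/2`
  have hopen : IsOpen {z : ℂ | -1 / 2 < z.im} := isOpen_lt continuous_const Complex.continuous_im
  have hconn : IsPreconnected {z : ℂ | -1 / 2 < z.im} := (convex_halfSpace_im_gt (-1 / 2)).isPreconnected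
  have h27' : ∀ F : V, ⟪ℓ z, ((Pa F : V) : H)⟫_ℂ = B₁ z * ⟪ℓ z, (F : H)⟫_ℂ := by
    intro F
    set g : ℂ → ℂ := fun x ↦ ⟪ℓ x, ((Pa F : V) : H)⟫_ℂ - B₁ x * ⟪ℓ x, (F : H)⟫_ℂ with hg
    have hgdiff : DifferentiableOn ℂ g {z : ℂ | -1 / 2 < z.im} :=
      (han _).sub (hB₁diff.mul (han _))
    have hgan : AnalyticOnNhd ℂ g {z : ℂ | -1 / 2 < z.im} := hgdiff.analyticOnNhd hopen
    have hgU : ∀ x : ℂ, 0 < x.im → g x = 0 := by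
      intro x hx
      simp only [hg]
      rw [h27 F x hx, hB₁eq hx, sub_self]
    have hev : g =ᶠ[𝓝 I] 0 := by
      have hUopen : IsOpen {z : ℂ | 0 < z.im} := isOpen_lt continuous_const Complex.continuous_im
      filter_upwards [hUopen.mem_nhds hI] with x hx
      exact hgU x hx
    have h0 := hgan.eqOn_zero_of_preconnected_of_eventuallyEq_zero hconn hI' hev hz
    simp only [hg, Pi.zero_apply] at h0
    exact sub_eq_zero.1 h0
  -- (2.8) with `F` the projection of `ℓ z` onto `V`
  set F : V := V.orthogonalProjectionOnto (ℓ z) with hF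
  have hF1 : ⟪ℓ z, (F : H)⟫_ℂ = ((‖F‖ ^ 2 : ℝ) : ℂ) := by
    have h := Submodule.inner_orthogonalProjectionOnto_eq_of_mem_right F (ℓ z)
    -- h : ⟪proj (ℓ z), F⟫ = ⟪ℓ z, F⟫
    rw [← hF] at h
    rw [← h, inner_self_eq_norm_sq_to_K]; norm_cast
  have hF2 : ⟪ℓ z, ((Pa F : V) : H)⟫_ℂ = ⟪F, Pa F⟫_ℂ := by
    have h := Submodule.inner_orthogonalProjectionOnto_eq_of_mem_right (Pa F) (ℓ z)
    rw [← hF] at h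
    exact h.symm
  have hF0 : F ≠ 0 := by
    intro h0
    rw [hF, Submodule.orthogonalProjectionOnto_eq_zero_iff] at h0
    have := (Submodule.mem_orthogonal V (ℓ z)).1 h0 (ℓ I) (hℓmem I hI)
    exact hne I z hI' hz this
  have hFpos : 0 < ‖F‖ := norm_pos_iff.2 hF0
  -- `|B₁ z| ‖F‖² ≤ ‖F‖²`
  have hkey : ‖B₁ z‖ * ‖F‖ ^ 2 ≤ 1 * ‖F‖ ^ 2 := by
    have h1 : B₁ z * ((‖F‖ ^ 2 : ℝ) : ℂ) = ⟪F, Pa F⟫_ℂ := by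
      rw [← hF1, ← h27' F, hF2]
    have h2 : ‖⟪F, Pa F⟫_ℂ‖ ≤ ‖F‖ * ‖Pa F‖ := norm_inner_le_norm F (Pa F)
    have h3 : ‖Pa F‖ ≤ 1 * ‖F‖ := (Pa.le_opNorm F).trans (by gcongr)
    calc ‖B₁ z‖ * ‖F‖ ^ 2 = ‖B₁ z * ((‖F‖ ^ 2 : ℝ) : ℂ)‖ := by
          rw [norm_mul, Complex.norm_real, Real.norm_eq_abs, abs_of_nonneg (sq_nonneg _)]
      _ = ‖⟪F, Pa F⟫_ℂ‖ := by rw [h1]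
      _ ≤ ‖F‖ * (1 * ‖F‖) := h2.trans (by gcongr)
      _ = 1 * ‖F‖ ^ 2 := by ring
  exact le_of_mul_le_mul_right hkey (by positivity)

end SzegoSchur

/-! ### The concrete model: `L²(0, ∞)` and the kernel `1/(2πi(w̄ − z − i))` -/

namespace SzegoSchur

/-- The model function `t ↦ e^{−it w̄ − t/2}` has modulus `e^{−(Im w + 1/2) t}`. [folklore] -/
private theorem norm_model (w : ℂ) (t : ℝ) :
    ‖Complex.exp (-(I * (t : ℂ) * conj w) - (t : ℂ) / 2)‖ = Real.exp (-(w.im + 1 / 2) * t) := by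
  rw [Complex.norm_exp]
  congr 1
  simp only [Complex.sub_re, Complex.neg_re, Complex.mul_re, Complex.mul_im, Complex.I_re,
    Complex.I_im, Complex.ofReal_re, Complex.ofReal_im, Complex.conj_re, Complex.conj_im,
    Complex.div_ofNat_re]
  ring

/-- The model function is square integrable on `(0, ∞)` when `Im w > −1/2`. [folklore] -/
private theorem memLp_model {w : ℂ} (hw : -1 / 2 < w.im) :
    MemLp (fun t : ℝ ↦ Complex.exp (-(I * (t : ℂ) * conj w) - (t : ℂ) / 2)) 2
      (volume.restrict (Set.Ioi (0 : ℝ))) := by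
  have hcont : Continuous fun t : ℝ ↦ Complex.exp (-(I * (t : ℂ) * conj w) - (t : ℂ) / 2) := by
    fun_prop
  rw [memLp_two_iff_integrable_sq_norm hcont.aestronglyMeasurable]
  have h : IntegrableOn (fun t : ℝ ↦ Real.exp (-(2 * w.im + 1) * t)) (Set.Ioi 0) :=
    exp_neg_integrableOn_Ioi 0 (by linarith)
  refine (integrableOn_congr_fun (fun t _ ↦ ?_) measurableSet_Ioi).2 h
  rw [norm_model, ← Real.exp_nat_mul]
  congr 1
  push_cast
  ring

/-- The Gram integral: for `Im w, Im z > −1/2`,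
`∫₀^∞ conj(e^{−itw̄ − t/2}) e^{−it z̄ − t/2} dt = 1/(i(z̄ − w − i))` `= 2π L(z, w)`.
[cite: ConreyLi2000, proof of Theorem 2 (the kernel `L(w, z)`)] -/
theorem integral_model_mul_model {w z : ℂ} (hw : -1 / 2 < w.im) (hz : -1 / 2 < z.im) :
    ∫ t in Set.Ioi (0 : ℝ), conj (Complex.exp (-(I * (t : ℂ) * conj w) - (t : ℂ) / 2)) *
        Complex.exp (-(I * (t : ℂ) * conj z) - (t : ℂ) / 2)
      = 1 / (I * (conj z - w - I)) := by
  have hprod : ∀ t : ℝ, conj (Complex.exp (-(I * (t : ℂ) * conj w) - (t : ℂ) / 2)) *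
      Complex.exp (-(I * (t : ℂ) * conj z) - (t : ℂ) / 2)
      = Complex.exp ((I * (w - conj z) - 1) * (t : ℂ)) := by
    intro t
    rw [← Complex.exp_conj, ← Complex.exp_add]
    congr 1
    simp only [map_sub, map_neg, map_mul, Complex.conj_I, Complex.conj_ofReal, Complex.conj_conj,
      map_div₀, map_ofNat]
    ring
  simp_rw [hprod]
  have ha : (I * (w - conj z) - 1).re < 0 := by
    simp only [Complex.sub_re, Complex.mul_re, Complex.I_re, Complex.I_im, Complex.sub_im,
      Complex.conj_im, Complex.one_re]
    linarith
  rw [integral_exp_mul_complex_Ioi ha 0]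
  have key : I * (conj z - w - I) = -(I * (w - conj z) - 1) := by
    linear_combination (-1 : ℂ) * Complex.I_mul_I
  rw [Complex.ofReal_zero, mul_zero, Complex.exp_zero, key, div_neg, neg_div]

/-- **The printed statement (2.7)–(2.8) as a self-contained extension lemma.** If `B : ℂ → ℂ` is
such that the kernel `(1 − B(z)B̄(w))/(2πi(w̄ − z − i))` is positive semi-definite on finite subsets
of the open upper half-plane, i.e. `Re Σᵢⱼ c̄ᵢ cⱼ (1 − B(wᵢ)B̄(wⱼ))/(2πi(w̄ⱼ − wᵢ − i)) ≥ 0` for all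
finite families `wᵢ` with `Im wᵢ > 0` and all complex `cᵢ`, then `B` has an analytic extension
`B₁` to the half-plane `Im z > −1/2` which is bounded by one there. (No a priori regularity of `B`
is assumed; its analyticity on the upper half-plane is a consequence.) This is the step
"`B(z)` has an analytic extension to the half-plane `Im z > −1/2` … `|B(w)| ≤ 1` for `Im w > −1/2`"
of the printed proof, with `𝓗` realised in `L²(0, ∞)` through `L(z, w) = (1/2π)∫₀^∞ e^{itw}
e^{−it z̄} e^{−t} dt`. [cite: ConreyLi2000, proof of Theorem 2, (2.7)–(2.8)] -/
theorem szego_schur_extension {B : ℂ → ℂ}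
    (hpsd : ∀ (ι : Type) (s : Finset ι) (w : ι → ℂ) (c : ι → ℂ), (∀ i ∈ s, 0 < (w i).im) →
      0 ≤ (∑ i ∈ s, ∑ j ∈ s, conj (c i) * c j * (1 - B (w i) * conj (B (w j))) /
        (2 * π * I * (conj (w j) - w i - I))).re) :
    ∃ B₁ : ℂ → ℂ, DifferentiableOn ℂ B₁ {z : ℂ | -1 / 2 < z.im} ∧
      Set.EqOn B₁ B {z : ℂ | 0 < z.im} ∧ ∀ z : ℂ, -1 / 2 < z.im → ‖B₁ z‖ ≤ 1 := by
  classical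
  -- the Hilbert space and the kernel vectors
  let μ : Measure ℝ := volume.restrict (Set.Ioi (0 : ℝ))
  let m : ℂ → ℝ → ℂ := fun w t ↦ Complex.exp (-(I * (t : ℂ) * conj w) - (t : ℂ) / 2)
  let ℓ : ℂ → Lp ℂ 2 μ := fun w ↦
    if h : -1 / 2 < w.im then (memLp_model h).toLp (m w) else 0
  have hℓ : ∀ {w : ℂ} (hw : -1 / 2 < w.im), (ℓ w : ℝ → ℂ) =ᵐ[μ] m w := by
    intro w hw
    simp only [ℓ, dif_pos hw]
    exact MemLp.coeFn_toLp _
  -- Gram identity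
  have hgram : ∀ w z : ℂ, -1 / 2 < w.im → -1 / 2 < z.im →
      ⟪ℓ w, ℓ z⟫_ℂ = 1 / (I * (conj z - w - I)) := by
    intro w z hw hz
    rw [MeasureTheory.L2.inner_def]
    have : (fun t : ℝ ↦ ⟪(ℓ w : ℝ → ℂ) t, (ℓ z : ℝ → ℂ) t⟫_ℂ) =ᵐ[μ]
        fun t ↦ conj (m w t) * m z t := by
      filter_upwards [hℓ hw, hℓ hz] with t h1 h2
      rw [h1, h2, RCLike.inner_apply']
    rw [integral_congr_ae this]
    exact integral_model_mul_model hw hz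
  have hne : ∀ z w : ℂ, -1 / 2 < z.im → -1 / 2 < w.im → ⟪ℓ z, ℓ w⟫_ℂ ≠ 0 := by
    intro z w hz hw
    rw [hgram z w hz hw, one_div]
    apply inv_ne_zero
    apply mul_ne_zero Complex.I_ne_zero
    intro h
    have := congrArg Complex.im h
    simp only [Complex.sub_im, Complex.conj_im, Complex.I_im, Complex.zero_im] at this
    linarith
  -- holomorphy of the evaluations `z ↦ ⟪ℓ z, F⟫ = ∫₀^∞ e^{itz − t/2} F(t) dt`
  have han : ∀ F : Lp ℂ 2 μ, DifferentiableOn ℂ (fun z ↦ ⟪ℓ z, F⟫_ℂ) {z : ℂ | -1 / 2 < z.im} := by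
    intro F
    -- the integral representation
    let G : ℂ → ℝ → ℂ := fun z t ↦ Complex.exp (I * (t : ℂ) * z - (t : ℂ) / 2) * (F : ℝ → ℂ) t
    have hconj : ∀ (z : ℂ) (t : ℝ), conj (m z t) = Complex.exp (I * (t : ℂ) * z - (t : ℂ) / 2) := by
      intro z t
      simp only [m]
      rw [← Complex.exp_conj]
      congr 1
      simp only [map_sub, map_neg, map_mul, Complex.conj_I, Complex.conj_ofReal,
        Complex.conj_conj, map_div₀, map_ofNat]
      ring
    have hrepr : ∀ z : ℂ, -1 / 2 < z.im → ⟪ℓ z, F⟫_ℂ = ∫ t, G z t ∂μ := by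
      intro z hz
      rw [MeasureTheory.L2.inner_def]
      refine integral_congr_ae ?_
      filter_upwards [hℓ hz] with t h1
      rw [h1, RCLike.inner_apply', hconj]
    have hFmem : MemLp (F : ℝ → ℂ) 2 μ := Lp.memLp F
    -- differentiability of the integral at every point of the half-plane
    have hdiff : ∀ z₀ : ℂ, -1 / 2 < z₀.im → HasDerivAt (fun z ↦ ∫ t, G z t ∂μ)
        (∫ t, (I * (t : ℂ)) * G z₀ t ∂μ) z₀ := by
      intro z₀ hz₀
      set ε : ℝ := (z₀.im + 1 / 2) / 2 with hε
      have hε0 : 0 < ε := by rw [hε]; linarith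
      -- the exponential weights are in `L²`
      have hexpL2 : ∀ a : ℝ, 0 < a → MemLp (fun t : ℝ ↦ (Real.exp (-a * t) : ℂ)) 2 μ := by
        intro a ha
        have hc : Continuous fun t : ℝ ↦ (Real.exp (-a * t) : ℂ) := by fun_prop
        rw [memLp_two_iff_integrable_sq_norm hc.aestronglyMeasurable]
        have h : IntegrableOn (fun t : ℝ ↦ Real.exp (-(2 * a) * t)) (Set.Ioi 0) :=
          exp_neg_integrableOn_Ioi 0 (by linarith)
        refine (integrableOn_congr_fun (fun t _ ↦ ?_) measurableSet_Ioi).2 h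
        rw [Complex.norm_real, Real.norm_eq_abs, abs_of_pos (Real.exp_pos _), ← Real.exp_nat_mul]
        congr 1; push_cast; ring
      -- measurability of `G z`
      have hGmeas : ∀ z : ℂ, AEStronglyMeasurable (G z) μ := fun z ↦
        (Continuous.aestronglyMeasurable (by fun_prop)).mul (Lp.aestronglyMeasurable F)
      -- integrability of `G z₀`: `|e^{itz₀ − t/2}| = e^{−2ε t}` on `t > 0`
      have hnormexp : ∀ (z : ℂ) (t : ℝ), ‖Complex.exp (I * (t : ℂ) * z - (t : ℂ) / 2)‖
          = Real.exp (-(z.im + 1 / 2) * t) := by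
        intro z t
        rw [Complex.norm_exp]
        congr 1
        simp only [Complex.sub_re, Complex.mul_re, Complex.mul_im, Complex.I_re, Complex.I_im,
          Complex.ofReal_re, Complex.ofReal_im, Complex.div_ofNat_re]
        ring
      have hGint : Integrable (G z₀) μ := by
        have h1 : MemLp (fun t : ℝ ↦ Complex.exp (I * (t : ℂ) * z₀ - (t : ℂ) / 2)) 2 μ := by
          have hc : Continuous fun t : ℝ ↦ Complex.exp (I * (t : ℂ) * z₀ - (t : ℂ) / 2) := by
            fun_prop
          refine (MeasureTheory.memLp_two_iff_integrable_sq_norm hc.aestronglyMeasurable).2 ?_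
          have h : IntegrableOn (fun t : ℝ ↦ Real.exp (-(2 * z₀.im + 1) * t)) (Set.Ioi 0) :=
            exp_neg_integrableOn_Ioi 0 (by linarith)
          refine (integrableOn_congr_fun (fun t _ ↦ ?_) measurableSet_Ioi).2 h
          rw [hnormexp, ← Real.exp_nat_mul]
          congr 1; push_cast; ring
        exact h1.integrable_mul hFmem
      -- the dominating function
      let bound : ℝ → ℝ := fun t ↦
        ‖((2 / ε : ℝ) : ℂ) * (Real.exp (-(ε / 2) * t) : ℂ) * (F : ℝ → ℂ) t‖
      have hbound_int : Integrable bound μ := by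
        have h1 : MemLp (fun t : ℝ ↦ ((2 / ε : ℝ) : ℂ) * (Real.exp (-(ε / 2) * t) : ℂ)) 2 μ :=
          (hexpL2 (ε / 2) (by positivity)).const_mul ((2 / ε : ℝ) : ℂ)
        exact (h1.integrable_mul hFmem).norm
      refine (hasDerivAt_integral_of_dominated_loc_of_deriv_le (F := G)
        (F' := fun z t ↦ (I * (t : ℂ)) * G z t) (bound := bound)
        (Metric.ball_mem_nhds z₀ hε0) (Filter.Eventually.of_forall hGmeas) hGint
        ((Continuous.aestronglyMeasurable (by fun_prop)).mul (hGmeas z₀)) ?_ hbound_int ?_).2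
      · -- the bound `‖(it) G z t‖ ≤ bound t` for `t > 0`, `z ∈ ball z₀ ε`
        rw [MeasureTheory.ae_restrict_iff' measurableSet_Ioi]
        refine Filter.Eventually.of_forall fun t (ht : 0 < t) z hzb ↦ ?_
        have hzim : -1 / 2 + ε < z.im := by
          have h1 : |(z - z₀).im| ≤ ‖z - z₀‖ := Complex.abs_im_le_norm _
          have h2 : ‖z - z₀‖ < ε := by rwa [Metric.mem_ball, dist_eq_norm] at hzb
          have h3 : |z.im - z₀.im| < ε := by rw [← Complex.sub_im]; exact h1.trans_lt h2
          have h4 := (abs_lt.1 h3).1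
          rw [hε] at h4 ⊢; linarith
        have lhs : ‖I * (t : ℂ) * G z t‖ = t * Real.exp (-(z.im + 1 / 2) * t) * ‖(F : ℝ → ℂ) t‖ := by
          simp only [G, norm_mul, Complex.norm_I, one_mul, Complex.norm_real, Real.norm_eq_abs,
            abs_of_pos ht, hnormexp]
          ring
        have rhs : bound t = 2 / ε * Real.exp (-(ε / 2) * t) * ‖(F : ℝ → ℂ) t‖ := by
          simp only [bound, norm_mul, Complex.norm_real, Real.norm_eq_abs,
            abs_of_pos (show (0 : ℝ) < 2 / ε by positivity), abs_of_pos (Real.exp_pos _)]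
        rw [lhs, rhs]
        gcongr ?_ * _
        -- `t e^{−(Im z + 1/2)t} ≤ (2/ε) e^{−(ε/2) t}`
        have h5 : Real.exp (-(z.im + 1 / 2) * t) ≤ Real.exp (-ε * t) :=
          Real.exp_le_exp.2 (by nlinarith)
        have h6 : t ≤ 2 / ε * Real.exp (ε / 2 * t) := by
          have := Real.add_one_le_exp (ε / 2 * t)
          rw [div_mul_eq_mul_div, le_div_iff₀ hε0]
          nlinarith
        calc t * Real.exp (-(z.im + 1 / 2) * t) ≤ t * Real.exp (-ε * t) := by gcongr
          _ ≤ 2 / ε * Real.exp (ε / 2 * t) * Real.exp (-ε * t) := by gcongr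
          _ = 2 / ε * Real.exp (-(ε / 2) * t) := by
            rw [mul_assoc, ← Real.exp_add]; congr 1; ring_nf
      · refine Filter.Eventually.of_forall fun t z _ ↦ ?_
        have h1 : HasDerivAt (fun z : ℂ ↦ I * (t : ℂ) * z - (t : ℂ) / 2) (I * (t : ℂ)) z := by
          simpa using ((hasDerivAt_id z).const_mul (I * (t : ℂ))).sub_const ((t : ℂ) / 2)
        have h3 := h1.cexp.mul_const ((F : ℝ → ℂ) t)
        change HasDerivAt (fun x : ℂ ↦ Complex.exp (I * (t : ℂ) * x - (t : ℂ) / 2) * (F : ℝ → ℂ) t)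
          (I * (t : ℂ) * (Complex.exp (I * (t : ℂ) * z - (t : ℂ) / 2) * (F : ℝ → ℂ) t)) z
        rw [show I * (t : ℂ) * (Complex.exp (I * (t : ℂ) * z - (t : ℂ) / 2) * (F : ℝ → ℂ) t)
            = Complex.exp (I * (t : ℂ) * z - (t : ℂ) / 2) * (I * (t : ℂ)) * (F : ℝ → ℂ) t by ring]
        exact h3
    intro z hz
    have hopen : IsOpen {z : ℂ | -1 / 2 < z.im} := isOpen_lt continuous_const Complex.continuous_im
    refine (DifferentiableAt.differentiableWithinAt ?_)
    have hev : (fun z ↦ ⟪ℓ z, F⟫_ℂ) =ᶠ[𝓝 z] fun z ↦ ∫ t, G z t ∂μ := by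
      filter_upwards [hopen.mem_nhds hz] with x hx
      exact hrepr x hx
    exact (hev.differentiableAt_iff).2 (hdiff z hz).differentiableAt
  -- the positive semi-definiteness hypothesis in terms of `ℓ`
  have hpsd' : ∀ (ι : Type) (s : Finset ι) (w : ι → ℂ) (c : ι → ℂ), (∀ i ∈ s, 0 < (w i).im) →
      0 ≤ (∑ i ∈ s, ∑ j ∈ s,
        conj (c i) * c j * (1 - B (w i) * conj (B (w j))) * ⟪ℓ (w i), ℓ (w j)⟫_ℂ).re := by
    intro ι s w c hw
    have hterm : ∀ i ∈ s, ∀ j ∈ s,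
        conj (c i) * c j * (1 - B (w i) * conj (B (w j))) * ⟪ℓ (w i), ℓ (w j)⟫_ℂ
        = ((2 * π : ℝ) : ℂ) * (conj (c i) * c j * (1 - B (w i) * conj (B (w j))) /
          (2 * π * I * (conj (w j) - w i - I))) := by
      intro i hi j hj
      have hi' : (-1 / 2 : ℝ) < (w i).im := by have := hw i hi; linarith
      have hj' : (-1 / 2 : ℝ) < (w j).im := by have := hw j hj; linarith
      rw [hgram (w i) (w j) hi' hj']
      have hden : I * (conj (w j) - w i - I) ≠ 0 := by
        apply mul_ne_zero Complex.I_ne_zero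
        intro h
        have := congrArg Complex.im h
        simp only [Complex.sub_im, Complex.conj_im, Complex.I_im, Complex.zero_im] at this
        linarith [hw i hi, hw j hj]
      have hpi : ((2 * π : ℝ) : ℂ) ≠ 0 := Complex.ofReal_ne_zero.2 (by positivity)
      push_cast
      field_simp
    rw [Finset.sum_congr rfl fun i hi ↦ Finset.sum_congr rfl fun j hj ↦ hterm i hi j hj]
    simp_rw [← Finset.mul_sum]
    rw [Complex.re_ofReal_mul]
    exact mul_nonneg (by positivity) (hpsd ι s w c hw)
  exact schur_extension_abstract ℓ hne han B hpsd'

end SzegoSchur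

end Literature.Analysis.DeBrangesSpaces

end
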